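import Literature.AlgebraicGeometry.ShimuraVarieties.UnitaryCurveAuxiliarySymplecticModuleV
import Literature.AlgebraicGeometry.ShimuraVarieties.UnitaryAuxiliaryIntegralFrame
import HarnessLib

/-!
# The `W₀`-free auxiliary form `ψ_V = Tr_{M/ℚ}(ξ·ᵗc(x)·H^j·y)` is alternating and non-degenerate, and admits an
# integral symplectic frame of some polarisation type `δ` adapted to any lattice (Frobenius)

Topic `AlgebraicGeometry/ShimuraVarieties`; namespace `Literature.AlgebraicGeometry.ShimuraVarieties.UnitaryCurve.AuxV`.
Theorems only (no definition, no named fact, no instance).  Cell `hodgecm-mathlib` (D-0151), FLOOR 0, P6 «MOD programme», door (E)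
of `stub_RGD`, organ **E1 FILE 5** — the `V_M`-twins (any rank `n`, ★ `auxGramV`/`auxFormV`/`SymplecticFrameV` of
★ `UnitaryCurveAuxiliarySymplecticModuleV`) of ★ `UnitaryAuxiliarySymplecticNondegenerate` and ★ `UnitaryAuxiliaryIntegralFrame`
(rank 3, `W₀ ⊕ V_M`), which the E-LINE chart `stub_E123` of `Cruxes/HLiu418/Lines/F0_P6a_PELWitnessE.lean` uses to PICK the
dimension `g`, the polarisation type `δ` and the symplectic frame `β` of the Siegel target ([RapoportSmithlingZhang2020Diagonal]
Remark 3.2 (ii)(iii): `Sh(G̃) → Sh(GU(V)) → 𝒜_g`).  `--supports stmt-HodgeConjecture-24832`, count-neutral; HC_CM is proved only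
modulo the printed citations until rung 0 closes.

For a CM field `M`, a field `L` with `j : L →+* M`, `H ∈ M_n(L)` with `H^j` HERMITIAN (`(H^j)ᴴ = H^j`) and `H` INVERTIBLE (`IsUnit H` — the
unitary Shimura curve's `J⋆` has signature `(1,1)` and is not anisotropic, so invertibility, not anisotropy, is the hypothesis), and a
nonzero purely imaginary `ξ ∈ M` (`c ξ = -ξ`):

* §1 `conjTranspose_auxGramV` (`(ξ·H^j)ᴴ = -ξ·H^j`), `auxFormV_self_eq_zero` (ALTERNATING: `c(ᵗc(x)Gx) = -ᵗc(x)Gx` and `Tr ∘ c = Tr`),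
  `det_auxGramV_ne_zero` (`det(ξ·H^j) = ξⁿ·j(det H) ≠ 0`), `auxFormV_nondegenerate` (NON-DEGENERATE: Mathlib ★ `traceForm_nondegenerate`
  for the separable `M/ℚ` and `G` invertible) — the sentence «`ψ` is a non-degenerate alternating form on `V`» of
  [Deligne1979ShimuraVarieties, Prop. 2.3.10] / [Milne2005ShimuraVarieties, §8 p. 81] without the auxiliary line `W₀`.
* §2 dimension bookkeeping of a frame: `SymplecticFrameV.add_self_eq` (`g + g = n·[M:ℚ]`), `SymplecticFrameV.pos` (`0 < g` for `n ≠ 0`),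
  `SymplecticFrameV.eq_finrank_of_two` (`n = 2 ⇒ g = [M:ℚ]`, the E-line's `AuxChartGS.g_eq`).
* §3 `auxGramV_smul`, `auxFormV_smul` (`ψ_{aξ} = a·ψ_ξ`) and **`exists_symplecticFrameV_integral`**: for ANY `ℚ`-basis `c` of `M^n` there are
  `k > 0`, `g > 0`, a polarisation type `δ`, a symplectic frame `Fr : SymplecticFrameV M j H (k•ξ) g δ` and an integer matrix `T` invertible
  over `ℤ` with `Fr.β = T ∘ c⁎` — so `Fr.β⁻¹(ℤ^{2g})` is exactly the `ℤ`-span of `c` (★ `exists_integral_frobenius_frame`, Frobenius'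
  elementary divisor theorem [AdkinsWeintraub1992, Ch. 6 Thm. 2.35]); conjunct order = ★ rank-3 `exists_symplecticFrame_integral` token for token.
* §4 bookkeeping for the rescaled `k•ξ`: `complexConj_rat_smul_eq_neg`, `rat_smul_ne_zero'`, `im_ringHom_rat_smul`, `im_ringHom_rat_smul_neg`
  (the sign hypothesis `Im ρ(ξ) < 0` of ★ `neg_auxComplexStructureV_mem_C0` survives `ξ ↦ k•ξ`, `k > 0`).

## References
* [Deligne1979ShimuraVarieties] P. Deligne, *Variétés de Shimura* (1979), Prop. 2.3.10 (PDF p. 32 of Milne's translation).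
* [Milne2005ShimuraVarieties] J. S. Milne, *Introduction to Shimura varieties* (2005), §6 p. 67, §8 p. 81.
* [RapoportSmithlingZhang2020Diagonal] M. Rapoport, B. Smithling, W. Zhang, *Arithmetic diagonal cycles on unitary Shimura varieties*,
  Compos. Math. 156 (2020), Remark 3.2 (ii)(iii) pp. 9–10.
* [AdkinsWeintraub1992] W. Adkins, S. Weintraub, *Algebra — an approach via module theory*, GTM 136, Ch. 6 Thm. 2.35 (p. 361).
-/

set_option autoImplicit false

noncomputable section

open Matrix NumberField
open Literature.AlgebraicGeometry.ModuliOfAbelianVarieties Literature.LinearAlgebra.FreeModule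

namespace Literature.AlgebraicGeometry.ShimuraVarieties

namespace UnitaryCurve

namespace AuxV

open Literature.AlgebraicGeometry.ShimuraVarieties.UnitaryCanonicalModel.Aux (conjAlgHom conjAlgHom_apply ratBasis ringHom_complexConj
  map_intCast_mul)

/-! ### §1. `ξ·H^j` is skew-hermitian and invertible; `ψ_V` is alternating and non-degenerate -/

section Nondegenerate

variable {L : Type} [Field L] {M : Type} [Field M] [NumberField M] [IsCMField M] (j : L →+* M)
  {n : ℕ} (H : Matrix (Fin n) (Fin n) L) (ξ : M)

/-- `star` on a CM field is complex conjugation (Mathlib's `IsCMField.starRing`, definitional). [cite: Deligne1979ShimuraVarieties, 2.3.9 (PDF p. 32)] -/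
private theorem star_eq_complexConj (x : M) : star x = IsCMField.complexConj M x := rfl

/-- **`G = ξ·H^j` is skew-hermitian**: `Gᴴ = -G` for `H^j` hermitian and `ξ` purely imaginary.
[cite: Deligne1979ShimuraVarieties, Prop. 2.3.10 (PDF p. 32)] [cite: Milne2005ShimuraVarieties, §8 p. 81] -/
theorem conjTranspose_auxGramV (hH : (H.map j)ᴴ = H.map j) (hξ : IsCMField.complexConj M ξ = -ξ) :
    (auxGramV M j H ξ)ᴴ = -auxGramV M j H ξ := by
  rw [auxGramV, conjTranspose_smul, hH, star_eq_complexConj, hξ, neg_smul]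

/-- `ᵗc(v) G w`, conjugated, is `-ᵗc(w) G v` for the skew-hermitian `G = ξ·H^j`. [cite: Deligne1979ShimuraVarieties, Prop. 2.3.10 (PDF p. 32)] -/
theorem star_dotProduct_auxGramV_mulVec (hG : (auxGramV M j H ξ)ᴴ = -auxGramV M j H ξ) (v w : Fin n → M) :
    star (star v ⬝ᵥ (auxGramV M j H ξ *ᵥ w)) = -(star w ⬝ᵥ (auxGramV M j H ξ *ᵥ v)) := by
  rw [star_dotProduct, star_mulVec, star_star, ← dotProduct_mulVec, hG, neg_mulVec, dotProduct_neg]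

/-- **`ψ_V` is alternating**: `ψ_V(v, v) = 0` (`ᵗc(v)·G·v` is purely imaginary and `Tr(c z) = Tr z`).
[cite: Deligne1979ShimuraVarieties, Prop. 2.3.10 (PDF p. 32)] [cite: Milne2005ShimuraVarieties, §8 p. 81] -/
theorem auxFormV_self_eq_zero (hH : (H.map j)ᴴ = H.map j) (hξ : IsCMField.complexConj M ξ = -ξ) (v : Fin n → M) :
    auxFormV M j H ξ v v = 0 := by
  have hG := conjTranspose_auxGramV j H ξ hH hξ
  set z : M := star v ⬝ᵥ (auxGramV M j H ξ *ᵥ v) with hz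
  have hψ : auxFormV M j H ξ v v = Algebra.trace ℚ M z := by
    rw [auxFormV_apply]
    rfl
  have hcz : IsCMField.complexConj M z = -z := by
    rw [← star_eq_complexConj, hz]
    exact star_dotProduct_auxGramV_mulVec j H ξ hG v v
  have htr : Algebra.trace ℚ M z = Algebra.trace ℚ M (IsCMField.complexConj M z) :=
    (Algebra.trace_eq_of_algEquiv ((IsCMField.complexConj M).restrictScalars ℚ) z).symm
  rw [hcz, map_neg] at htr
  rw [hψ]
  linarith

omit [NumberField M] [IsCMField M] in
/-- **`G = ξ·H^j` is invertible** for `ξ ≠ 0` and `H` invertible: `det G = ξⁿ · j(det H) ≠ 0`.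
[cite: Deligne1979ShimuraVarieties, Prop. 2.3.10 (PDF p. 32)] -/
theorem det_auxGramV_ne_zero (hξ : ξ ≠ 0) (hHu : IsUnit H) : (auxGramV M j H ξ).det ≠ 0 := by
  have hdetH : H.det ≠ 0 := ((Matrix.isUnit_iff_isUnit_det H).mp hHu).ne_zero
  have hdetHj : (H.map j).det ≠ 0 := by
    rw [← RingHom.mapMatrix_apply, ← RingHom.map_det]
    exact (map_ne_zero j).mpr hdetH
  rw [auxGramV, det_smul, Fintype.card_fin]
  exact mul_ne_zero (pow_ne_zero _ hξ) hdetHj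

/-- `ψ_V x y = Tr((ᵗc(x)·G) ⬝ y)` (the Gram vector moved to the left argument). [cite: Milne2005ShimuraVarieties, §8 p. 81] -/
private theorem auxFormV_eq_trace_vecMul (x y : Fin n → M) :
    auxFormV M j H ξ x y = Algebra.trace ℚ M ((star x ᵥ* auxGramV M j H ξ) ⬝ᵥ y) := by
  rw [auxFormV_apply, dotProduct_mulVec]
  rfl

/-- **`ψ_V` is non-degenerate** (left and right separating): the trace form of `M/ℚ` is non-degenerate (Mathlib
★ `traceForm_nondegenerate`) and `G = ξ·H^j` is invertible. [cite: Deligne1979ShimuraVarieties, Prop. 2.3.10 (PDF p. 32)]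
[cite: Milne2005ShimuraVarieties, §8 p. 81] -/
theorem auxFormV_nondegenerate (hξ : ξ ≠ 0) (hHu : IsUnit H) : (auxFormV M j H ξ).Nondegenerate := by
  classical
  have hdet := det_auxGramV_ne_zero j H ξ hξ hHu
  have htr := traceForm_nondegenerate ℚ M
  refine ⟨fun x hx => ?_, fun y hy => ?_⟩
  · -- left: `star x ᵥ* G = 0`
    have hr : star x ᵥ* auxGramV M j H ξ = 0 := by
      funext k
      refine htr.1 _ fun m => ?_
      rw [Algebra.traceForm_apply]
      have := hx (Pi.single k m)
      rwa [auxFormV_eq_trace_vecMul, dotProduct_single] at this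
    have hx0 : star x = 0 := Matrix.eq_zero_of_vecMul_eq_zero hdet hr
    exact star_eq_zero.mp hx0
  · -- right: `G *ᵥ y = 0`
    have hr : auxGramV M j H ξ *ᵥ y = 0 := by
      funext i
      refine htr.2 _ fun m => ?_
      rw [Algebra.traceForm_apply]
      have := hy (star (Pi.single i m))
      rwa [auxFormV_eq_trace_vecMul, star_star, ← dotProduct_mulVec, single_dotProduct] at this
    exact Matrix.eq_zero_of_mulVec_eq_zero hdet hr

end Nondegenerate

/-! ### §2. Dimension bookkeeping of a symplectic frame: `2g = n·[M:ℚ]` -/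

section Dimension

variable {L : Type} [Field L] {M : Type} [Field M] [NumberField M] [IsCMField M] {j : L →+* M}
  {n : ℕ} {H : Matrix (Fin n) (Fin n) L} {ξ : M} {g : ℕ} {δ : Fin g → ℕ}

omit [IsCMField M] in
/-- `dim_ℚ M^n = n·[M:ℚ]`. [cite: Milne2005ShimuraVarieties, §6 p. 67] -/
private theorem finrank_fin_fun_eq : Module.finrank ℚ (Fin n → M) = n * Module.finrank ℚ M := by
  rw [Module.finrank_pi_fintype ℚ, Finset.sum_const, Finset.card_univ, Fintype.card_fin, smul_eq_mul]

/-- **A symplectic frame forces `2g = n·[M:ℚ]`**: `β : M^n ≃ ℚ^{g ⊕ g}` is a `ℚ`-linear isomorphism.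
[cite: Milne2005ShimuraVarieties, §6 p. 67] [cite: RapoportSmithlingZhang2020Diagonal, Remark 3.2 (ii)(iii) pp. 9–10] -/
theorem SymplecticFrameV.add_self_eq (Fr : SymplecticFrameV M j H ξ g δ) : g + g = n * Module.finrank ℚ M := by
  have h := Fr.β.finrank_eq
  rw [finrank_fin_fun_eq, Module.finrank_fintype_fun_eq_card, Fintype.card_sum, Fintype.card_fin] at h
  exact h.symm

/-- **`0 < g`** as soon as `n ≠ 0` (`M ≠ 0`). [cite: Milne2005ShimuraVarieties, §6 p. 67] -/
theorem SymplecticFrameV.pos [NeZero n] (Fr : SymplecticFrameV M j H ξ g δ) : 0 < g := by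
  have h := Fr.add_self_eq
  have hM : 0 < Module.finrank ℚ M := Module.finrank_pos
  have hn : 0 < n := Nat.pos_of_ne_zero (NeZero.ne n)
  have : 0 < n * Module.finrank ℚ M := Nat.mul_pos hn hM
  omega

/-- **The unitary CURVE (`n = 2`): `g = [M:ℚ]`** — the E-line's `AuxChartGS.g_eq` (`g = [F:ℚ]` at `M = F`).
[cite: RapoportSmithlingZhang2020Diagonal, Remark 3.2 (ii)(iii) pp. 9–10] -/
theorem SymplecticFrameV.eq_finrank_of_two {H₂ : Matrix (Fin 2) (Fin 2) L} (Fr : SymplecticFrameV M j H₂ ξ g δ) :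
    g = Module.finrank ℚ M := by
  have h := Fr.add_self_eq
  omega

end Dimension

/-! ### §3. Scaling `ξ` and the integral symplectic frame adapted to a lattice -/

section Frame

variable {L : Type} [Field L] {M : Type} [Field M] [NumberField M] [IsCMField M] (j : L →+* M)
  {n : ℕ} (H : Matrix (Fin n) (Fin n) L) (ξ : M)

omit [IsCMField M] in
/-- `auxGramV` is `ℚ`-linear in `ξ`: `G(aξ) = a • G(ξ)`. [cite: Deligne1979ShimuraVarieties, Prop. 2.3.10 (PDF p. 32)] -/
theorem auxGramV_smul (a : ℚ) : auxGramV M j H (a • ξ) = a • auxGramV M j H ξ := by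
  unfold auxGramV
  rw [smul_assoc]

/-- `auxFormV` is `ℚ`-linear in `ξ`: `ψ_{aξ} = a · ψ_ξ`. [cite: Deligne1979ShimuraVarieties, Prop. 2.3.10 (PDF p. 32)] -/
theorem auxFormV_smul (a : ℚ) (v w : Fin n → M) : auxFormV M j H (a • ξ) v w = a * auxFormV M j H ξ v w := by
  rw [auxFormV_apply, auxFormV_apply, auxGramV_smul, Matrix.smul_mulVec, dotProduct_smul, map_smul, smul_eq_mul]

/-- **Integral symplectic frame adapted to a lattice, `W₀`-free** (Deligne's auxiliary construction, step "choose a lattice and a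
polarisation type", for `GU(V)` alone): for `ψ_V = auxFormV M j H ξ` (`H^j` hermitian, `H` invertible, `ξ` nonzero purely imaginary,
`n ≠ 0`) and any `ℚ`-basis `c` of `M^n`, there are `k > 0`, `g > 0`, a polarisation type `δ` and a symplectic frame `Fr` of type `δ` for
`auxFormV M j H (k•ξ) = k•ψ_V` whose coordinates are `Fr.β = T ∘ c⁎` with `T` an integer matrix invertible over `ℤ`; thus
`Fr.β⁻¹(ℤ^{2g}) = ℤ`-span of `c`.  Conjunct order = ★ rank-3 `exists_symplecticFrame_integral`.
[cite: Deligne1979ShimuraVarieties, Prop. 2.3.10 (PDF p. 32)] [cite: RapoportSmithlingZhang2020Diagonal, Remark 3.2 (ii)(iii) pp. 9–10]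
[cite: AdkinsWeintraub1992, Ch. 6 Thm. 2.35 (p. 361)] -/
theorem exists_symplecticFrameV_integral [NeZero n] {N : Type*} [Fintype N] [DecidableEq N]
    (c : Module.Basis N ℚ (Fin n → M)) (hH : (H.map j)ᴴ = H.map j) (hHu : IsUnit H) (hξ : ξ ≠ 0)
    (hξc : IsCMField.complexConj M ξ = -ξ) :
    ∃ (k g : ℕ) (δ : Fin g → ℕ) (Fr : SymplecticFrameV M j H ((k : ℚ) • ξ) g δ)
      (T : Matrix (Fin g ⊕ Fin g) N ℤ) (T' : Matrix N (Fin g ⊕ Fin g) ℤ),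
      0 < k ∧ 0 < g ∧ IsPolarizationType δ ∧ T * T' = 1 ∧ T' * T = 1 ∧ Fintype.card N = g + g ∧
      ∀ u, Fr.β u = T.map (Int.cast : ℤ → ℚ) *ᵥ c.equivFun u := by
  classical
  obtain ⟨k, g, d, T, T', hk, hcard, hdpos, hchain, hTT', hT'T, hgram⟩ :=
    exists_integral_frobenius_frame c (auxFormV M j H ξ)
      (auxFormV_self_eq_zero j H ξ hH hξc) (auxFormV_nondegenerate j H ξ hξ hHu)
  -- the coordinate isomorphism `β = T ∘ c⁎`
  let Tq : Matrix (Fin g ⊕ Fin g) N ℚ := T.map (Int.cast : ℤ → ℚ)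
  let T'q : Matrix N (Fin g ⊕ Fin g) ℚ := T'.map (Int.cast : ℤ → ℚ)
  have h1 : Tq * T'q = 1 := by
    simp only [Tq, T'q]
    rw [← map_intCast_mul, hTT', Matrix.map_one Int.cast Int.cast_zero Int.cast_one]
  have h2 : T'q * Tq = 1 := by
    simp only [Tq, T'q]
    rw [← map_intCast_mul, hT'T, Matrix.map_one Int.cast Int.cast_zero Int.cast_one]
  let θ : (N → ℚ) ≃ₗ[ℚ] (Fin g ⊕ Fin g → ℚ) :=
    LinearEquiv.ofLinear (Matrix.toLin' Tq) (Matrix.toLin' T'q)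
      (by rw [← Matrix.toLin'_mul, h1, Matrix.toLin'_one])
      (by rw [← Matrix.toLin'_mul, h2, Matrix.toLin'_one])
  have hθ : ∀ x, θ x = Tq *ᵥ x := fun x => Matrix.toLin'_apply Tq x
  let β : (Fin n → M) ≃ₗ[ℚ] (Fin g ⊕ Fin g → ℚ) := c.equivFun.trans θ
  have hβ : ∀ u, β u = Tq *ᵥ c.equivFun u := fun u => by
    simp only [β, LinearEquiv.trans_apply, hθ]
  have hform : typeFormOver d ℚ = (Matrix.fromBlocks 0 (Matrix.diagonal fun i => (d i : ℤ))
      (-Matrix.diagonal fun i => (d i : ℤ)) 0).map (Int.cast : ℤ → ℚ) := rfl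
  let Fr : SymplecticFrameV M j H ((k : ℚ) • ξ) g d :=
    ⟨β, fun v w => by rw [auxFormV_smul, hgram v w, hβ, hβ, hform]⟩
  exact ⟨k, g, d, Fr, T, T', hk, Fr.pos, ⟨hdpos, hchain⟩, hTT', hT'T, hcard, hβ⟩

/-- An integer matrix applied to an integer vector, read in `ℚ`. [cite: AdkinsWeintraub1992, Ch. 6 Thm. 2.35 (p. 361)] -/
private theorem map_intCast_mulVec_intCast {m m' : Type*} [Fintype m'] (A : Matrix m m' ℤ) (x : m' → ℤ) :
    (A.map (Int.cast : ℤ → ℚ) *ᵥ fun i => (x i : ℚ)) = fun a => ((A *ᵥ x) a : ℚ) := by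
  funext a
  simp only [Matrix.mulVec, dotProduct, Matrix.map_apply, Int.cast_sum, Int.cast_mul]

/-- **The lattice of the frame is the `ℤ`-span of `c`**: with `Fr.β = T ∘ c⁎` and `T ∈ GL(ℤ)`, a vector `u ∈ M^n` has INTEGER
symplectic coordinates iff its `c`-coordinates are integers. [cite: AdkinsWeintraub1992, Ch. 6 Thm. 2.35 (p. 361)]
[cite: Milne2005ShimuraVarieties, §6 p. 67] -/
theorem forall_exists_intCast_eq_iff {N : Type*} [Fintype N] [DecidableEq N] {g : ℕ} {δ : Fin g → ℕ} {ξ' : M}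
    (c : Module.Basis N ℚ (Fin n → M)) (Fr : SymplecticFrameV M j H ξ' g δ)
    (T : Matrix (Fin g ⊕ Fin g) N ℤ) (T' : Matrix N (Fin g ⊕ Fin g) ℤ) (hT'T : T' * T = 1)
    (hβ : ∀ u, Fr.β u = T.map (Int.cast : ℤ → ℚ) *ᵥ c.equivFun u) (u : Fin n → M) :
    (∃ z : Fin g ⊕ Fin g → ℤ, Fr.β u = fun a => (z a : ℚ)) ↔ ∃ y : N → ℤ, c.equivFun u = fun i => (y i : ℚ) := by
  constructor
  · rintro ⟨z, hz⟩
    refine ⟨T' *ᵥ z, ?_⟩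
    have h := hβ u
    rw [hz] at h
    -- apply `T'` to both sides
    have h' : T'.map (Int.cast : ℤ → ℚ) *ᵥ (fun a => (z a : ℚ)) =
        T'.map (Int.cast : ℤ → ℚ) *ᵥ (T.map (Int.cast : ℤ → ℚ) *ᵥ c.equivFun u) := by rw [h]
    rw [Matrix.mulVec_mulVec, ← map_intCast_mul, hT'T, Matrix.map_one Int.cast Int.cast_zero Int.cast_one,
      Matrix.one_mulVec, map_intCast_mulVec_intCast] at h'
    exact h'.symm
  · rintro ⟨y, hy⟩
    refine ⟨T *ᵥ y, ?_⟩
    rw [hβ, hy, map_intCast_mulVec_intCast]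

end Frame

/-! ### §4. Bookkeeping for the rescaled `k•ξ` (purely imaginary, nonzero, same signs at the complex places) -/

section Rescale

variable {M : Type} [Field M] (ξ : M)

/-- `c(a•ξ) = -(a•ξ)` for `c ξ = -ξ` and `a ∈ ℚ`. [cite: Deligne1979ShimuraVarieties, Prop. 2.3.10 (PDF p. 32)] -/
theorem complexConj_rat_smul_eq_neg [NumberField M] [IsCMField M] (hξc : IsCMField.complexConj M ξ = -ξ) (a : ℚ) :
    IsCMField.complexConj M (a • ξ) = -(a • ξ) := by
  rw [map_rat_smul, hξc, smul_neg]

/-- `k•ξ ≠ 0` for `k ≠ 0`, `ξ ≠ 0`. [cite: Deligne1979ShimuraVarieties, Prop. 2.3.10 (PDF p. 32)] -/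
theorem nat_smul_ne_zero [CharZero M] {k : ℕ} (hk : 0 < k) (hξ : ξ ≠ 0) : (k : ℚ) • ξ ≠ 0 :=
  smul_ne_zero (Nat.cast_ne_zero.mpr hk.ne') hξ

/-- `Im ρ(a•ξ) = a · Im ρ(ξ)` at a complex embedding `ρ`. [cite: Milne2005ShimuraVarieties, §6 p. 68] -/
theorem im_ringHom_rat_smul [CharZero M] (ρ : M →+* ℂ) (a : ℚ) : (ρ (a • ξ)).im = a * (ρ ξ).im := by
  rw [Rat.smul_def, map_mul, map_ratCast, ← Complex.ofReal_ratCast, Complex.im_ofReal_mul]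

/-- **The sign hypothesis survives rescaling**: `Im ρ(ξ) < 0` and `k > 0` give `Im ρ(k•ξ) < 0` (the hypothesis `hξ` of
★ `neg_auxComplexStructureV_mem_C0` for the frame of `exists_symplecticFrameV_integral`). [cite: Milne2005ShimuraVarieties, §6 p. 68] -/
theorem im_ringHom_nat_smul_neg [CharZero M] (ρ : M →+* ℂ) {k : ℕ} (hk : 0 < k) (h : (ρ ξ).im < 0) : (ρ ((k : ℚ) • ξ)).im < 0 := by
  rw [im_ringHom_rat_smul, Rat.cast_natCast]
  exact mul_neg_of_pos_of_neg (Nat.cast_pos.mpr hk) h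

end Rescale

end AuxV

end UnitaryCurve

end Literature.AlgebraicGeometry.ShimuraVarieties

end
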